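import Summits.ValiantsHypothesis.ValiantsHypothesis.Theorems.KPlusLogSqLawTropicalBBoundarySectorDefs

/-!
# Route «KPlusLogSqLaw», crux `TropicalB` (stmt-ValiantsHypothesis-19771) — THRESHOLD CODES: `3L` boundaries (pairs of orders)
# whose pattern bits encode every entry of a `2^L × 2^L` matrix

HONEST FRAMING.  Helper toward the registered stubs `stub_tropThin` / `stub_tropFat` of `Cruxes/TropicalB/Lines/birth.lean`
(crux `Summit.ValiantsHypothesis.ValiantsHypothesis.Theses.KPlusLogSqLaw.TropicalB`, item `stmt-ValiantsHypothesis-19771`, route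
`KPlusLogSqLaw`; cell `pub-symmetroid`, seat val-sym-trop-p1 g15, 2026-08-28; `--supports … --as helper`).  Pure combinatorics for the
boundary-type (permutation-register) sector of `…TropicalBBoundarySectorDefs` (p447010: `BoundarySector.pattern` /
`IsBoundaryDesign` / `BoundaryVertexLaw`); no definition is introduced (the code is packaged as an existence theorem).  It bounds nothing
and bears on neither `TropicalB`, `WeakLifting`, DoorA26 / DoorA34, `MatrixDescartes` (stmt-ValiantsHypothesis-18050) nor VP ≠ VNP.
Consumed by the THRESHOLD NORMAL FORM (companion file `…TropicalBThresholdNormalForm`: every static design of size `2^L` is dominated, in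
vertex count, by a DENSE boundary-type design over any entry-separating boundary family — so `O(log m)` boundaries are universal).

THE CODE (size `2^L`, digits `t < L`).  Write `a = lo + 2^t·β + 2^(t+1)·hi` with `lo < 2^t`, `β = a_t ∈ {0,1}` (`digit_decomp`) and put
`md = lo + 2^t·hi < 2^(L−1)` (`md_lt`; the number with digit `t` deleted).  The keys `κ_t a = β·2^(L−1) + md` («digit `t` moved to the
top») and `κ̄_t a = (1−β)·2^(L−1) + md` («moved to the top and flipped») are injective on `[0, 2^L)` into `[0, 2^L)`, hence permutations of
`Fin (2^L)`, and digit `t` contributes the three boundaries (order pairs) `(κ_t, κ_t)`, `(κ̄_t, κ̄_t)`, `(κ_t, κ̄_t)`.  DECODING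
(`digits_eq_of_keys`, stated for abstract keys `β·H + md`, `md < H`): the first two comparison bits at `(a, b)` differ iff `a_t ≠ b_t`, and
then the first one is `[a_t < b_t]`; if they agree, the third bit is `[a_t = 0]`.  So the `3L` bits determine every digit of `a` and of `b`
(`eq_of_digits`), i.e. (`exists_injective_code`) there are `π ρ : Fin (3L) → Equiv.Perm (Fin (2^L))` whose pattern map
`(a, b) ↦ pattern π ρ a b` is INJECTIVE on `Fin (2^L) × Fin (2^L)`.  Counting shows `B ≥ 2L` boundaries are necessary (`2^B ≥ 4^L`
patterns), so the code is optimal up to the factor `3/2`.  [elementary; this cell]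
-/

set_option linter.dupNamespace false
set_option autoImplicit false

namespace Summit.ValiantsHypothesis.ValiantsHypothesis.Theorems.KPlusLogSqLaw

namespace BoundarySector

open Finset

/-! ## 1. Decoding one digit from three comparisons (abstract keys) -/

/-- **Decoding one digit.**  Keys `β·H + m` («digit on top») and `(1−β)·H + m` («digit on top, flipped») with digits `β ≤ 1` and
tails `m < H`: if the three comparisons `[βa·H+ma < βb·H+mb]`, `[(1−βa)·H+ma < (1−βb)·H+mb]`, `[βa·H+ma < (1−βb)·H+mb]` agree for
`(a, b)` and `(a', b')`, then `βa = βa'` and `βb = βb'`. [this cell] -/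
theorem digits_eq_of_keys {H βa βb βa' βb' ma mb ma' mb' : ℕ} (h1a : βa ≤ 1) (h1b : βb ≤ 1) (h1a' : βa' ≤ 1) (h1b' : βb' ≤ 1)
    (hma : ma < H) (hmb : mb < H) (hma' : ma' < H) (hmb' : mb' < H)
    (h1 : βa * H + ma < βb * H + mb ↔ βa' * H + ma' < βb' * H + mb')
    (h2 : (1 - βa) * H + ma < (1 - βb) * H + mb ↔ (1 - βa') * H + ma' < (1 - βb') * H + mb')
    (h3 : βa * H + ma < (1 - βb) * H + mb ↔ βa' * H + ma' < (1 - βb') * H + mb') :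
    βa = βa' ∧ βb = βb' := by
  interval_cases βa <;> interval_cases βb <;> interval_cases βa' <;> interval_cases βb' <;> omega

/-! ## 2. Binary digits by division -/

/-- reconstruction of a number from its low part, its digit `t` and its high part. [folklore] -/
theorem digit_decomp (t a : ℕ) : a = a % 2 ^ t + 2 ^ t * (a / 2 ^ t % 2) + 2 ^ (t + 1) * (a / 2 ^ (t + 1)) := by
  have h1 : 2 ^ t * (a / 2 ^ t) + a % 2 ^ t = a := Nat.div_add_mod a (2 ^ t)
  have h2 : 2 * (a / 2 ^ t / 2) + a / 2 ^ t % 2 = a / 2 ^ t := Nat.div_add_mod (a / 2 ^ t) 2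
  have h3 : a / 2 ^ t / 2 = a / 2 ^ (t + 1) := by rw [Nat.div_div_eq_div_mul, ← pow_succ]
  rw [h3] at h2
  have h4 : (2 : ℕ) ^ (t + 1) = 2 ^ t * 2 := pow_succ 2 t
  calc a = 2 ^ t * (a / 2 ^ t) + a % 2 ^ t := h1.symm
    _ = 2 ^ t * (2 * (a / 2 ^ (t + 1)) + a / 2 ^ t % 2) + a % 2 ^ t := by rw [h2]
    _ = a % 2 ^ t + 2 ^ t * (a / 2 ^ t % 2) + 2 ^ (t + 1) * (a / 2 ^ (t + 1)) := by rw [h4]; ring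

/-- the deleted-digit number `a % 2^t + 2^t·(a / 2^(t+1))` keeps the low part … [folklore] -/
theorem md_mod (t a : ℕ) : (a % 2 ^ t + 2 ^ t * (a / 2 ^ (t + 1))) % 2 ^ t = a % 2 ^ t := by
  rw [Nat.add_mul_mod_self_left, Nat.mod_mod]

/-- … and the high part. [folklore] -/
theorem md_div (t a : ℕ) : (a % 2 ^ t + 2 ^ t * (a / 2 ^ (t + 1))) / 2 ^ t = a / 2 ^ (t + 1) := by
  rw [Nat.add_mul_div_left _ _ (by positivity), Nat.div_eq_of_lt (Nat.mod_lt _ (by positivity)), zero_add]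

/-- the digit and the deleted-digit number determine the number. [folklore] -/
theorem eq_of_digit_md {t a b : ℕ} (h1 : a / 2 ^ t % 2 = b / 2 ^ t % 2)
    (h2 : a % 2 ^ t + 2 ^ t * (a / 2 ^ (t + 1)) = b % 2 ^ t + 2 ^ t * (b / 2 ^ (t + 1))) : a = b := by
  have hlo : a % 2 ^ t = b % 2 ^ t := by rw [← md_mod t a, ← md_mod t b, h2]
  have hhi : a / 2 ^ (t + 1) = b / 2 ^ (t + 1) := by rw [← md_div t a, ← md_div t b, h2]
  rw [digit_decomp t a, digit_decomp t b, hlo, h1, hhi]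

/-- the deleted-digit number is `< 2^(L−1)` when `a < 2^L` and `t < L`. [folklore] -/
theorem md_lt {L t a : ℕ} (ha : a < 2 ^ L) (ht : t < L) : a % 2 ^ t + 2 ^ t * (a / 2 ^ (t + 1)) < 2 ^ (L - 1) := by
  have hlo : a % 2 ^ t < 2 ^ t := Nat.mod_lt _ (by positivity)
  have hhi : a / 2 ^ (t + 1) < 2 ^ (L - 1 - t) := by
    rw [Nat.div_lt_iff_lt_mul (by positivity)]
    calc a < 2 ^ L := ha
      _ = 2 ^ (L - 1 - t) * 2 ^ (t + 1) := by rw [← pow_add]; congr 1; omega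
  have e : (2 : ℕ) ^ (L - 1) = 2 ^ t * 2 ^ (L - 1 - t) := by rw [← pow_add]; congr 1; omega
  rw [e]
  have h1 : a / 2 ^ (t + 1) + 1 ≤ 2 ^ (L - 1 - t) := hhi
  calc a % 2 ^ t + 2 ^ t * (a / 2 ^ (t + 1)) < 2 ^ t + 2 ^ t * (a / 2 ^ (t + 1)) := by omega
    _ = 2 ^ t * (a / 2 ^ (t + 1) + 1) := by ring
    _ ≤ 2 ^ t * 2 ^ (L - 1 - t) := Nat.mul_le_mul_left _ h1

/-- the digits below `L` determine a number `< 2^L`. [folklore] -/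
theorem eq_of_digits {L a a' : ℕ} (ha : a < 2 ^ L) (ha' : a' < 2 ^ L) (h : ∀ t < L, a / 2 ^ t % 2 = a' / 2 ^ t % 2) :
    a = a' := by
  refine Nat.eq_of_testBit_eq fun i => ?_
  by_cases hi : i < L
  · rw [Nat.testBit_eq_decide_div_mod_eq, Nat.testBit_eq_decide_div_mod_eq, h i hi]
  · have hL : 2 ^ L ≤ 2 ^ i := Nat.pow_le_pow_right (by norm_num) (by omega)
    rw [Nat.testBit_eq_false_of_lt (lt_of_lt_of_le ha hL), Nat.testBit_eq_false_of_lt (lt_of_lt_of_le ha' hL)]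

/-- `2^L = 2^(L−1) + 2^(L−1)` for `L ≥ 1`. [folklore] -/
theorem two_pow_eq_add {L : ℕ} (hL : 1 ≤ L) : (2 : ℕ) ^ L = 2 ^ (L - 1) + 2 ^ (L - 1) := by
  obtain ⟨L', rfl⟩ : ∃ L', L = L' + 1 := ⟨L - 1, by omega⟩
  simp [pow_succ]; ring

/-! ## 3. The code -/

/-- **THRESHOLD CODE.**  There are `3L` pairs of orders `(π j, ρ j)` of `Fin (2^L)` whose pattern map
`(a, b) ↦ (j ↦ [π j a < ρ j b])` is injective: every entry of a `2^L × 2^L` matrix is encoded by `3L` order-comparison bits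
(boundary `finProdFinEquiv (r, t)`: `(κ_t, κ_t)`, `(κ̄_t, κ̄_t)`, `(κ_t, κ̄_t)` for `r = 0, 1, 2`). [this cell] -/
theorem exists_injective_code (L : ℕ) :
    ∃ π ρ : Fin (3 * L) → Equiv.Perm (Fin (2 ^ L)),
      Function.Injective fun ab : Fin (2 ^ L) × Fin (2 ^ L) => pattern π ρ ab.1 ab.2 := by
  classical
  -- the two keys of digit `t`
  let md : ℕ → ℕ → ℕ := fun t a => a % 2 ^ t + 2 ^ t * (a / 2 ^ (t + 1))
  let key : ℕ → ℕ → ℕ := fun t a => a / 2 ^ t % 2 * 2 ^ (L - 1) + md t a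
  let keyb : ℕ → ℕ → ℕ := fun t a => (1 - a / 2 ^ t % 2) * 2 ^ (L - 1) + md t a
  have hbit : ∀ t a : ℕ, a / 2 ^ t % 2 ≤ 1 := fun t a => Nat.lt_succ_iff.mp (Nat.mod_lt _ two_pos)
  have key_lt : ∀ t, t < L → ∀ a, a < 2 ^ L → key t a < 2 ^ L := by
    intro t ht a ha
    have h1 := md_lt ha ht
    have h2 := hbit t a
    have h3 : a / 2 ^ t % 2 * 2 ^ (L - 1) ≤ 2 ^ (L - 1) :=
      (Nat.mul_le_mul_right _ h2).trans (one_mul _).le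
    show a / 2 ^ t % 2 * 2 ^ (L - 1) + (a % 2 ^ t + 2 ^ t * (a / 2 ^ (t + 1))) < 2 ^ L
    rw [two_pow_eq_add (show 1 ≤ L by omega)]
    omega
  have keyb_lt : ∀ t, t < L → ∀ a, a < 2 ^ L → keyb t a < 2 ^ L := by
    intro t ht a ha
    have h1 := md_lt ha ht
    have h2 : 1 - a / 2 ^ t % 2 ≤ 1 := Nat.sub_le _ _
    have h3 : (1 - a / 2 ^ t % 2) * 2 ^ (L - 1) ≤ 2 ^ (L - 1) :=
      (Nat.mul_le_mul_right _ h2).trans (one_mul _).le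
    show (1 - a / 2 ^ t % 2) * 2 ^ (L - 1) + (a % 2 ^ t + 2 ^ t * (a / 2 ^ (t + 1))) < 2 ^ L
    rw [two_pow_eq_add (show 1 ≤ L by omega)]
    omega
  -- injectivity of the keys on `[0, 2^L)`
  have key_inj : ∀ t, t < L → ∀ a b : ℕ, a < 2 ^ L → b < 2 ^ L → key t a = key t b → a = b := by
    intro t ht a b ha hb h
    have hma := md_lt ha ht
    have hmb := md_lt hb ht
    have h2a := hbit t a
    have h2b := hbit t b
    change a / 2 ^ t % 2 * 2 ^ (L - 1) + (a % 2 ^ t + 2 ^ t * (a / 2 ^ (t + 1))) =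
      b / 2 ^ t % 2 * 2 ^ (L - 1) + (b % 2 ^ t + 2 ^ t * (b / 2 ^ (t + 1))) at h
    have hβ : a / 2 ^ t % 2 = b / 2 ^ t % 2 := by
      generalize hH : 2 ^ (L - 1) = H at *
      generalize hβa : a / 2 ^ t % 2 = βa at *
      generalize hβb : b / 2 ^ t % 2 = βb at *
      generalize hxa : a % 2 ^ t + 2 ^ t * (a / 2 ^ (t + 1)) = xa at *
      generalize hxb : b % 2 ^ t + 2 ^ t * (b / 2 ^ (t + 1)) = xb at *
      interval_cases βa <;> interval_cases βb <;> omega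
    refine eq_of_digit_md hβ ?_
    rw [hβ] at h
    omega
  have keyb_inj : ∀ t, t < L → ∀ a b : ℕ, a < 2 ^ L → b < 2 ^ L → keyb t a = keyb t b → a = b := by
    intro t ht a b ha hb h
    have hma := md_lt ha ht
    have hmb := md_lt hb ht
    have h2a := hbit t a
    have h2b := hbit t b
    change (1 - a / 2 ^ t % 2) * 2 ^ (L - 1) + (a % 2 ^ t + 2 ^ t * (a / 2 ^ (t + 1))) =
      (1 - b / 2 ^ t % 2) * 2 ^ (L - 1) + (b % 2 ^ t + 2 ^ t * (b / 2 ^ (t + 1))) at h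
    have hβ : a / 2 ^ t % 2 = b / 2 ^ t % 2 := by
      generalize hH : 2 ^ (L - 1) = H at *
      generalize hβa : a / 2 ^ t % 2 = βa at *
      generalize hβb : b / 2 ^ t % 2 = βb at *
      generalize hxa : a % 2 ^ t + 2 ^ t * (a / 2 ^ (t + 1)) = xa at *
      generalize hxb : b % 2 ^ t + 2 ^ t * (b / 2 ^ (t + 1)) = xb at *
      interval_cases βa <;> interval_cases βb <;> omega
    refine eq_of_digit_md hβ ?_
    rw [hβ] at h
    omega
  -- the permutations `κ_t`, `κ̄_t` of `Fin (2^L)` (for `t : Fin L`)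
  let f : Fin L → Fin (2 ^ L) → Fin (2 ^ L) := fun t a => ⟨key t a, key_lt t t.isLt a a.isLt⟩
  let g : Fin L → Fin (2 ^ L) → Fin (2 ^ L) := fun t a => ⟨keyb t a, keyb_lt t t.isLt a a.isLt⟩
  have hf : ∀ t, Function.Bijective (f t) := fun t =>
    Finite.injective_iff_bijective.mp fun a b h =>
      Fin.ext (key_inj t t.isLt a b a.isLt b.isLt (by simpa [f] using congrArg Fin.val h))
  have hg : ∀ t, Function.Bijective (g t) := fun t =>
    Finite.injective_iff_bijective.mp fun a b h =>
      Fin.ext (keyb_inj t t.isLt a b a.isLt b.isLt (by simpa [g] using congrArg Fin.val h))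
  let P : Fin L → Equiv.Perm (Fin (2 ^ L)) := fun t => Equiv.ofBijective (f t) (hf t)
  let Q : Fin L → Equiv.Perm (Fin (2 ^ L)) := fun t => Equiv.ofBijective (g t) (hg t)
  have hPP : ∀ t (a b : Fin (2 ^ L)), P t a < P t b ↔ key t a < key t b := fun t a b => Iff.rfl
  have hQQ : ∀ t (a b : Fin (2 ^ L)), Q t a < Q t b ↔ keyb t a < keyb t b := fun t a b => Iff.rfl
  have hPQ : ∀ t (a b : Fin (2 ^ L)), P t a < Q t b ↔ key t a < keyb t b := fun t a b => Iff.rfl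
  -- the boundary family: boundary `finProdFinEquiv (r, t)`
  let π : Fin (3 * L) → Equiv.Perm (Fin (2 ^ L)) := fun j =>
    if ((finProdFinEquiv.symm j).1 : ℕ) = 1 then Q (finProdFinEquiv.symm j).2 else P (finProdFinEquiv.symm j).2
  let ρ : Fin (3 * L) → Equiv.Perm (Fin (2 ^ L)) := fun j =>
    if ((finProdFinEquiv.symm j).1 : ℕ) = 0 then P (finProdFinEquiv.symm j).2 else Q (finProdFinEquiv.symm j).2
  have hπ0 : ∀ t : Fin L, π (finProdFinEquiv ((0 : Fin 3), t)) = P t := fun t => by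
    simp only [π, Equiv.symm_apply_apply, Fin.val_zero, zero_ne_one, if_false]
  have hρ0 : ∀ t : Fin L, ρ (finProdFinEquiv ((0 : Fin 3), t)) = P t := fun t => by
    simp only [ρ, Equiv.symm_apply_apply, Fin.val_zero, if_true]
  have hπ1 : ∀ t : Fin L, π (finProdFinEquiv ((1 : Fin 3), t)) = Q t := fun t => by
    simp only [π, Equiv.symm_apply_apply, Fin.val_one, if_true]
  have hρ1 : ∀ t : Fin L, ρ (finProdFinEquiv ((1 : Fin 3), t)) = Q t := fun t => by
    simp only [ρ, Equiv.symm_apply_apply, Fin.val_one, one_ne_zero, if_false]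
  have h2val : ((2 : Fin 3) : ℕ) = 2 := rfl
  have hπ2 : ∀ t : Fin L, π (finProdFinEquiv ((2 : Fin 3), t)) = P t := fun t => by
    simp only [π, Equiv.symm_apply_apply, h2val, show (2 : ℕ) ≠ 1 from by decide, if_false]
  have hρ2 : ∀ t : Fin L, ρ (finProdFinEquiv ((2 : Fin 3), t)) = Q t := fun t => by
    simp only [ρ, Equiv.symm_apply_apply, h2val, show (2 : ℕ) ≠ 0 from by decide, if_false]
  refine ⟨π, ρ, ?_⟩
  rintro ⟨a, b⟩ ⟨a', b'⟩ h
  simp only at h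
  have bit : ∀ j, (π j a < ρ j b ↔ π j a' < ρ j b') := fun j => by
    have := congrFun h j
    simpa only [pattern, decide_eq_decide] using this
  have key3 : ∀ t : Fin L, (a : ℕ) / 2 ^ (t : ℕ) % 2 = (a' : ℕ) / 2 ^ (t : ℕ) % 2 ∧
      (b : ℕ) / 2 ^ (t : ℕ) % 2 = (b' : ℕ) / 2 ^ (t : ℕ) % 2 := by
    intro t
    have e0 := bit (finProdFinEquiv ((0 : Fin 3), t))
    have e1 := bit (finProdFinEquiv ((1 : Fin 3), t))
    have e2 := bit (finProdFinEquiv ((2 : Fin 3), t))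
    rw [hπ0, hρ0, hPP, hPP] at e0
    rw [hπ1, hρ1, hQQ, hQQ] at e1
    rw [hπ2, hρ2, hPQ, hPQ] at e2
    exact digits_eq_of_keys (hbit t a) (hbit t b) (hbit t a') (hbit t b')
      (md_lt a.isLt t.isLt) (md_lt b.isLt t.isLt) (md_lt a'.isLt t.isLt) (md_lt b'.isLt t.isLt) e0 e1 e2
  have ha : (a : ℕ) = a' := eq_of_digits a.isLt a'.isLt fun t ht => (key3 ⟨t, ht⟩).1
  have hb : (b : ℕ) = b' := eq_of_digits b.isLt b'.isLt fun t ht => (key3 ⟨t, ht⟩).2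
  rw [Fin.ext ha, Fin.ext hb]

/-- counting converse (for the record): an injective pattern map on `Fin m × Fin m` needs `m² ≤ 2^B` patterns. [folklore] -/
theorem sq_le_two_pow_of_injective {m B : ℕ} (π ρ : Fin B → Equiv.Perm (Fin m))
    (h : Function.Injective fun ab : Fin m × Fin m => pattern π ρ ab.1 ab.2) : m * m ≤ 2 ^ B := by
  classical
  have := Fintype.card_le_of_injective _ h
  simpa [Fintype.card_prod, Fintype.card_fin, Fintype.card_fun, Fintype.card_bool] using this

end BoundarySector

end Summit.ValiantsHypothesis.ValiantsHypothesis.Theorems.KPlusLogSqLaw
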